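import Summits.CriticalPhenomena.PercolationContinuityZ3.Theorems.Transplant.SkelFrmBChoiceRootRunY
import Summits.CriticalPhenomena.PercolationContinuityZ3.Theorems.Transplant.SkelFrmBChoiceRootLanding2
import Summits.CriticalPhenomena.PercolationContinuityZ3.Theorems.Transplant.SkelPhiNegReachRoomsRead
import Summits.CriticalPhenomena.PercolationContinuityZ3.Theorems.Transplant.SkelFrmBChoiceDefsT
import HarnessLib

/-!
# N2 (frames-only node `SamePDropOfSkeletonFrm₁`, OPEN), (R) column, reading rows: **THE FIVE ROOT READING-ROW PROPS** `KS.RowX1`, `KS.RowXA`,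
# `KS.RowX2`, `KS.RowY`, `KS.RowYA` — the targets BY NAME of stmt-g22's `SkelFrmBChoiceRootReadRows` (lane INBOX 16:17:05Z "YES") and the five
# reading hypotheses of the (R) legs `NegB.rootLeg_fst/snd_Q3V_of_rows` (SkelFrm1RootHoldsQ3VR)

Each Prop is ONE box-reading row `l₀ ≤ rdLo₀ ∧ rdHi₀ ≤ h₀ ∧ l₁ ≤ rdLo₁ ∧ rdHi₁ ≤ h₁` of the fine reading
`rdLo/rdHi (Aof κ) n_L h_L v_L vβL (prFA).c₀ (prFA).c₁ (prFA).D lo hi` (SkelPhiNegReachRoomsRead) at a LITERAL `t`-frame box `[lo, hi]` of the root's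
chain (p3-g18's ask 15:56:57Z, specs (R-X1)/(R-XA)/(R-X2)/(R-Y)/(R-YA)); the boxes are exactly the corner values of the geometry lemmas
`KS.rootRegion_mem_box / rootLast_mem_box` (SkelFrmBChoiceRootReadX), `KS.prefixRegion_mem_box / yRegion_mem_box / yLast_mem_box` (SkelFrmBChoiceRootReadY),
window- and cell-generic (`qx Wx`, `qxY WxY`, creep `c`, target half-sides `b`).  stmt proves them at the tuple (`readLo/Hi_of_budgetK` pattern of `hPl_Q`);
the (R) legs consume them (`KS.hfoot₂_R … hrow`, etc.).  Definitions only.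
NON-VACUITY (lead g11 standing order): Props, no claims.
builds on p205010 (kernel theorem, internal audit signed; external expert review pending) — nothing in this file uses p205010; NOTHING is claimed
about the open node `SamePDropOfSkeletonFrm₁`.
Lane `prim-bschramm`, seat `prim-bschramm-p3` (gen 18; N2 design owner, (R) column owner); helper file (`--supports stmt-CriticalPhenomena-4575 --as helper`).
[cite: KozmaNitzan2024, §4 p. 28 ((32) at the root)]
-/

noncomputable section

open scoped Classical

namespace Summit.CriticalPhenomena.PercolationContinuityZ3.Theorems.Transplant

open Literature.Probability.Percolation Literature.Probability.LatticeModels SimpleGraph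
open SkelConc (Consts)
open Skelφ (kgSL kgZ₀ kgZ₁ kgM₁ kgM₂ kgWm₂ kgWp₂ kgZY₀ kgZY₁ kgM₁Y kgM₂Y kgWm₂Y kgWp₂Y rdLo rdHi)

namespace PlanarSkeletonFrm

namespace NegB

open Neg

namespace KS

section Rows

variable (κ : Consts) {V : Type} [DecidableEq V] [Countable V] {G : SimpleGraph V} [G.LocallyFinite] (Φ : PlanarSkeletonFrm G) (t : V) (p : unitInterval)
  (D : Skelφ.StepI.DataNS V)

/-- **ONE BOX-READING ROW** of the fine reading of record (`rdLo/rdHi (Aof κ) n_L h_L v_L vβL (prFA).c₀ (prFA).c₁ (prFA).D`, SkelPhiNegReachRoomsRead)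
for the `t`-frame box `[lo, hi]`: `l₀ ≤ rdLo₀ ∧ rdHi₀ ≤ h₀ ∧ l₁ ≤ rdLo₁ ∧ rdHi₁ ≤ h₁` (fine units). [this work] -/
def ReadRow (g f : ℕ) (lo hi : Site 2) (l₀ h₀ l₁ h₁ : ℤ) : Prop :=
  l₀ ≤ rdLo (Aof κ) (nL κ Φ t p D g f) (hL κ Φ t p D g f) (vL κ Φ t p D g f) (vβL κ Φ t p D g f) (prFA κ Φ t p D g f).c₀ (prFA κ Φ t p D g f).c₁ (prFA κ Φ t p D g f).D lo hi 0 ∧ rdHi (Aof κ) (nL κ Φ t p D g f) (hL κ Φ t p D g f) (vL κ Φ t p D g f) (vβL κ Φ t p D g f) (prFA κ Φ t p D g f).c₀ (prFA κ Φ t p D g f).c₁ (prFA κ Φ t p D g f).D lo hi 0 ≤ h₀ ∧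
    l₁ ≤ rdLo (Aof κ) (nL κ Φ t p D g f) (hL κ Φ t p D g f) (vL κ Φ t p D g f) (vβL κ Φ t p D g f) (prFA κ Φ t p D g f).c₀ (prFA κ Φ t p D g f).c₁ (prFA κ Φ t p D g f).D lo hi 1 ∧ rdHi (Aof κ) (nL κ Φ t p D g f) (hL κ Φ t p D g f) (vL κ Φ t p D g f) (vβL κ Φ t p D g f) (prFA κ Φ t p D g f).c₀ (prFA κ Φ t p D g f).c₁ (prFA κ Φ t p D g f).D lo hi 1 ≤ h₁

/-- `ReadRow` unfolded. [folklore] -/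
theorem readRow_iff (g f : ℕ) (lo hi : Site 2) (l₀ h₀ l₁ h₁ : ℤ) : ReadRow κ Φ t p D g f lo hi l₀ h₀ l₁ h₁ ↔
    l₀ ≤ rdLo (Aof κ) (nL κ Φ t p D g f) (hL κ Φ t p D g f) (vL κ Φ t p D g f) (vβL κ Φ t p D g f) (prFA κ Φ t p D g f).c₀ (prFA κ Φ t p D g f).c₁ (prFA κ Φ t p D g f).D lo hi 0 ∧ rdHi (Aof κ) (nL κ Φ t p D g f) (hL κ Φ t p D g f) (vL κ Φ t p D g f) (vβL κ Φ t p D g f) (prFA κ Φ t p D g f).c₀ (prFA κ Φ t p D g f).c₁ (prFA κ Φ t p D g f).D lo hi 0 ≤ h₀ ∧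
      l₁ ≤ rdLo (Aof κ) (nL κ Φ t p D g f) (hL κ Φ t p D g f) (vL κ Φ t p D g f) (vβL κ Φ t p D g f) (prFA κ Φ t p D g f).c₀ (prFA κ Φ t p D g f).c₁ (prFA κ Φ t p D g f).D lo hi 1 ∧ rdHi (Aof κ) (nL κ Φ t p D g f) (hL κ Φ t p D g f) (vL κ Φ t p D g f) (vβL κ Φ t p D g f) (prFA κ Φ t p D g f).c₀ (prFA κ Φ t p D g f).c₁ (prFA κ Φ t p D g f).D lo hi 1 ≤ h₁ := Iff.rfl

/-- **(R-X1) THE ROOT x-CORRIDOR's READING ROW**: the `t`-frame box `[(−Z₀, −(Z₁ + sL)), ((N+1)n_L + Z₀ + 4n_L + qx, Z₁ + sL)]` (the (C) prism of record at `(qx, Wx)`, `N := kgNv0`, widened by `(0, sL | 4n_L + qx, sL)` for the root's shifted origin `c₁* = t + (X1, Y1s)` and its `dec₁`-longer prism) reads within `[−5r₀ + 1, 25r₀ − 1] × [−3r₁ + 1, 3r₁ − 1]` (fine units; root foot `RootFootT … (0, true)`). [this work] -/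
def RowX1 (mk g f qx Wx : ℕ) : Prop :=
  ReadRow κ Φ t p D g f
    (![-kgZ₀ (nL κ Φ t p D g f) (vL κ Φ t p D g f) (kgR κ Φ t p D mk) 0 (kgq κ Φ t p D g f qx) (kgNv0 κ Φ t p D g f mk qx Wx) (kgM₁ (nL κ Φ t p D g f) (ℓL κ Φ t p D g f) (hL κ Φ t p D g f) (kgR κ Φ t p D mk) 0 (kgW κ Φ t p D g f Wx) (kgNv0 κ Φ t p D g f mk qx Wx)) (kgM₂ (nL κ Φ t p D g f) (ℓL κ Φ t p D g f) (hL κ Φ t p D g f) (vL κ Φ t p D g f) (kgR κ Φ t p D mk) 0 (kgq κ Φ t p D g f qx) (kgW κ Φ t p D g f Wx) (kgNv0 κ Φ t p D g f mk qx Wx)), -(kgZ₁ (nL κ Φ t p D g f) (ℓL κ Φ t p D g f) (hL κ Φ t p D g f) (kgR κ Φ t p D mk) 0 (kgW κ Φ t p D g f Wx) (kgNv0 κ Φ t p D g f mk qx Wx) (kgM₁ (nL κ Φ t p D g f) (ℓL κ Φ t p D g f) (hL κ Φ t p D g f) (kgR κ Φ t p D mk) 0 (kgW κ Φ t p D g f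 Wx) (kgNv0 κ Φ t p D g f mk qx Wx)) (kgWm₂ (nL κ Φ t p D g f) (ℓL κ Φ t p D g f) (hL κ Φ t p D g f) (kgR κ Φ t p D mk) 0 (kgW κ Φ t p D g f Wx) (kgNv0 κ Φ t p D g f mk qx Wx)) (kgWp₂ (nL κ Φ t p D g f) (ℓL κ Φ t p D g f) (hL κ Φ t p D g f) (kgR κ Φ t p D mk) 0 (kgW κ Φ t p D g f Wx) (kgNv0 κ Φ t p D g f mk qx Wx)) (kgM₂ (nL κ Φ t p D g f) (ℓL κ Φ t p D g f) (hL κ Φ t p D g f) (vL κ Φ t p D g f) (kgR κ Φ t p D mk) 0 (kgq κ Φ t p D g f qx) (kgW κ Φ t p D g f Wx) (kgNv0 κ Φ t p D g f mk qx Wx)) + kgSL (nL κ Φ t p D g f) (ℓL κ Φ t p D g f) (hL κ Φ t p D g f))])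
    (![((((kgNv0 κ Φ t p D g f mk qx Wx) : ℕ) : ℤ) + 1) * (nL κ Φ t p D g f : ℤ) + kgZ₀ (nL κ Φ t p D g f) (vL κ Φ t p D g f) (kgR κ Φ t p D mk) 0 (kgq κ Φ t p D g f qx) (kgNv0 κ Φ t p D g f mk qx Wx) (kgM₁ (nL κ Φ t p D g f) (ℓL κ Φ t p D g f) (hL κ Φ t p D g f) (kgR κ Φ t p D mk) 0 (kgW κ Φ t p D g f Wx) (kgNv0 κ Φ t p D g f mk qx Wx)) (kgM₂ (nL κ Φ t p D g f) (ℓL κ Φ t p D g f) (hL κ Φ t p D g f) (vL κ Φ t p D g f) (kgR κ Φ t p D mk) 0 (kgq κ Φ t p D g f qx) (kgW κ Φ t p D g f Wx) (kgNv0 κ Φ t p D g f mk qx Wx)) + 4 * (nL κ Φ t p D g f : ℤ) + (qx : ℤ), kgZ₁ (nL κ Φ t p D g f) (ℓL κ Φ t p D g f) (hL κ Φ t p D g f) (kgR κ Φ t p D mk) 0 (kgW κ Φ t p D g f Wx) (kgNv0 κ Φ t p D g f mk qx Wx) (kgM₁ (nL κ Φ t p D g f) (ℓL κ Φ t p D g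 f) (hL κ Φ t p D g f) (kgR κ Φ t p D mk) 0 (kgW κ Φ t p D g f Wx) (kgNv0 κ Φ t p D g f mk qx Wx)) (kgWm₂ (nL κ Φ t p D g f) (ℓL κ Φ t p D g f) (hL κ Φ t p D g f) (kgR κ Φ t p D mk) 0 (kgW κ Φ t p D g f Wx) (kgNv0 κ Φ t p D g f mk qx Wx)) (kgWp₂ (nL κ Φ t p D g f) (ℓL κ Φ t p D g f) (hL κ Φ t p D g f) (kgR κ Φ t p D mk) 0 (kgW κ Φ t p D g f Wx) (kgNv0 κ Φ t p D g f mk qx Wx)) (kgM₂ (nL κ Φ t p D g f) (ℓL κ Φ t p D g f) (hL κ Φ t p D g f) (vL κ Φ t p D g f) (kgR κ Φ t p D mk) 0 (kgq κ Φ t p D g f qx) (kgW κ Φ t p D g f Wx) (kgNv0 κ Φ t p D g f mk qx Wx)) + kgSL (nL κ Φ t p D g f) (ℓL κ Φ t p D g f) (hL κ Φ t p D g f)])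
    (-(5 * (((fcellsA κ Φ t p D g f).r 0 : ℕ) : ℤ)) + 1) (25 * (((fcellsA κ Φ t p D g f).r 0 : ℕ) : ℤ) - 1)
    (-(3 * (((fcellsA κ Φ t p D g f).r 1 : ℕ) : ℤ)) + 1) (3 * (((fcellsA κ Φ t p D g f).r 1 : ℕ) : ℤ) - 1)

/-- **(R-XA) THE ROOT's x-ARRIVAL READING ROW**: the (C) arrival box `[kgLastLo (kgNv0), kgLastHi (kgNv0)]` of the rows of record `kgRows0_of … mk qx Wx` widened by `(3n_L, 2sL | 3n_L, 1)` (`KS.rootBoxX_R`) reads within the target cube: `|rd₀ − 20r₀| ≤ b 0 − 1`, `|rd₁ − c0| ≤ b 1 − 1` (`c0 := (fcellsT … c).c 0`, target foot `TargetFootT … b (0, true)`). [this work] -/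
def RowXA (mk g f qx Wx : ℕ) (c b : Fin 2 → ℕ) (hN : EqNumL κ Φ t p D g f) (hg : gFloorKG κ Φ t p D mk ≤ g) : Prop :=
  ReadRow κ Φ t p D g f
    (![((kgRows0_of κ Φ t p D g f mk qx Wx hN hg).kgLastLo (kgNv0 κ Φ t p D g f mk qx Wx)) 0 - 3 * (nL κ Φ t p D g f : ℤ), ((kgRows0_of κ Φ t p D g f mk qx Wx hN hg).kgLastLo (kgNv0 κ Φ t p D g f mk qx Wx)) 1 - 2 * (kgSL (nL κ Φ t p D g f) (ℓL κ Φ t p D g f) (hL κ Φ t p D g f))])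
    (![((kgRows0_of κ Φ t p D g f mk qx Wx hN hg).kgLastHi (kgNv0 κ Φ t p D g f mk qx Wx)) 0 + 3 * (nL κ Φ t p D g f : ℤ), ((kgRows0_of κ Φ t p D g f mk qx Wx hN hg).kgLastHi (kgNv0 κ Φ t p D g f mk qx Wx)) 1 + 1])
    (20 * (((fcellsA κ Φ t p D g f).r 0 : ℕ) : ℤ) - (b 0 : ℤ) + 1) (20 * (((fcellsA κ Φ t p D g f).r 0 : ℕ) : ℤ) + (b 0 : ℤ) - 1)
    (((fcellsT κ Φ t p D g f c).c 0 : ℤ) - (b 1 : ℤ) + 1) (((fcellsT κ Φ t p D g f c).c 0 : ℤ) + (b 1 : ℤ) - 1)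

/-- **(R-X2) THE ROOT x-PREFIX's READING ROW** (second axis): the prefix prism box at `(qx, Wx) := (0, 0)`, `N := 30`, `[(−Z₀ᴾ, −Z₁ᴾ), (31n_L + Z₀ᴾ + 4n_L, Z₁ᴾ + 1)]` reads within `[−3r₀ + 1, 3r₀ − 1] × [−5r₁ + 1, 25r₁ − 1]` (root foot `RootFootT … (1, true)`). [this work] -/
def RowX2 (mk g f : ℕ) : Prop :=
  ReadRow κ Φ t p D g f
    (![-kgZ₀ (nL κ Φ t p D g f) (vL κ Φ t p D g f) (kgR κ Φ t p D mk) 0 (kgq κ Φ t p D g f 0) 30 (kgM₁ (nL κ Φ t p D g f) (ℓL κ Φ t p D g f) (hL κ Φ t p D g f) (kgR κ Φ t p D mk) 0 (kgW κ Φ t p D g f 0) 30) (kgM₂ (nL κ Φ t p D g f) (ℓL κ Φ t p D g f) (hL κ Φ t p D g f) (vL κ Φ t p D g f) (kgR κ Φ t p D mk) 0 (kgq κ Φ t p D g f 0) (kgW κ Φ t p D g f 0) 30), -kgZ₁ (nL κ Φ t p D g f) (ℓL κ Φ t p D g f) (hL κ Φ t p D g f) (kgR κ Φ t p D mk) 0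 (kgW κ Φ t p D g f 0) 30 (kgM₁ (nL κ Φ t p D g f) (ℓL κ Φ t p D g f) (hL κ Φ t p D g f) (kgR κ Φ t p D mk) 0 (kgW κ Φ t p D g f 0) 30) (kgWm₂ (nL κ Φ t p D g f) (ℓL κ Φ t p D g f) (hL κ Φ t p D g f) (kgR κ Φ t p D mk) 0 (kgW κ Φ t p D g f 0) 30) (kgWp₂ (nL κ Φ t p D g f) (ℓL κ Φ t p D g f) (hL κ Φ t p D g f) (kgR κ Φ t p D mk) 0 (kgW κ Φ t p D g f 0) 30) (kgM₂ (nL κ Φ t p D g f) (ℓL κ Φ t p D g f) (hL κ Φ t p D g f) (vL κ Φ t p D g f) (kgR κ Φ t p D mk) 0 (kgq κ Φ t p D g f 0) (kgW κ Φ t p D g f 0) 30)])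
    (![((((30 : ℕ)) : ℤ) + 1) * (nL κ Φ t p D g f : ℤ) + kgZ₀ (nL κ Φ t p D g f) (vL κ Φ t p D g f) (kgR κ Φ t p D mk) 0 (kgq κ Φ t p D g f 0) 30 (kgM₁ (nL κ Φ t p D g f) (ℓL κ Φ t p D g f) (hL κ Φ t p D g f) (kgR κ Φ t p D mk) 0 (kgW κ Φ t p D g f 0) 30) (kgM₂ (nL κ Φ t p D g f) (ℓL κ Φ t p D g f) (hL κ Φ t p D g f) (vL κ Φ t p D g f) (kgR κ Φ t p D mk) 0 (kgq κ Φ t p D g f 0) (kgW κ Φ t p D g f 0) 30) + 4 * (nL κ Φ t p D g f : ℤ), kgZ₁ (nL κ Φ t p D g f) (ℓL κ Φ t p D g f) (hL κ Φ t p D g f) (kgR κ Φ t p D mk) 0 (kgW κ Φ t p D g f 0) 30 (kgM₁ (nL κ Φ t p D g f) (ℓL κ Φ t p D g f) (hL κ Φ t p D g f) (kgR κ Φ t p D mk) 0 (kgW κ Φ t p D g f 0) 30) (kgWm₂ (nL κ Φ t p D g f) (ℓL κ Φ t p D g f) (hL κ Φ t p D g f) (kgR κ Φ t p D mk) 0 (kgW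 κ Φ t p D g f 0) 30) (kgWp₂ (nL κ Φ t p D g f) (ℓL κ Φ t p D g f) (hL κ Φ t p D g f) (kgR κ Φ t p D mk) 0 (kgW κ Φ t p D g f 0) 30) (kgM₂ (nL κ Φ t p D g f) (ℓL κ Φ t p D g f) (hL κ Φ t p D g f) (vL κ Φ t p D g f) (kgR κ Φ t p D mk) 0 (kgq κ Φ t p D g f 0) (kgW κ Φ t p D g f 0) 30) + 1])
    (-(3 * (((fcellsA κ Φ t p D g f).r 0 : ℕ) : ℤ)) + 1) (3 * (((fcellsA κ Φ t p D g f).r 0 : ℕ) : ℤ) - 1)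
    (-(5 * (((fcellsA κ Φ t p D g f).r 1 : ℕ) : ℤ)) + 1) (25 * (((fcellsA κ Φ t p D g f).r 1 : ℕ) : ℤ) - 1)

/-- **(R-Y) THE ROOT y′-CORRIDOR's READING ROW**: the root y′-prism box (rows `kgYRows0_of … mk qxY (KS.WxYR …)`, `N := kgNYv0 mk qxY WxY`, origin `c₂ = t + (X2R, Y2R)`) `[(X2R − ZY₀ᴿ, −ZY₁ᴿ), (X2R + ZY₀ᴿ, (N+1)·P + ZY₁ᴿ + 1)]` reads within `[−3r₀ + 1, 3r₀ − 1] × [−5r₁ + 1, 25r₁ − 1]`. [this work] -/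
def RowY (mk g f qxY WxY : ℕ) : Prop :=
  ReadRow κ Φ t p D g f
    (![(((KS.X2R κ Φ t p D mk g f WxY) : ℕ) : ℤ) - kgZY₀ (nL κ Φ t p D g f) (vL κ Φ t p D g f) (kgR κ Φ t p D mk) 0 (kgWY κ Φ t p D g f (KS.WxYR κ Φ t p D mk g f WxY)) (kgNYv0 κ Φ t p D g f mk qxY WxY) (kgM₁Y (nL κ Φ t p D g f) (vL κ Φ t p D g f) (kgR κ Φ t p D mk) 0 (kgWY κ Φ t p D g f (KS.WxYR κ Φ t p D mk g f WxY)) (kgNYv0 κ Φ t p D g f mk qxY WxY)) (kgWm₂Y (nL κ Φ t p D g f) (vL κ Φ t p D g f) (kgR κ Φ t p D mk) 0 (kgWY κ Φ t p D g f (KS.WxYR κ Φ t p D mk g f WxY)) (kgNYv0 κ Φ t p D g f mk qxY WxY)) (kgWp₂Y (nL κ Φ t p D g f) (vL κ Φ t p D g f) (kgR κ Φ t p D mk) 0 (kgWY κ Φ t p D g f (KS.WxYR κ Φ t p D mk g f WxY)) (kgNYv0 κ Φ t p D g f mk qxY WxY)) (kgM₂Y (nL κ Φ t p D g f) (ℓL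 κ Φ t p D g f) (hL κ Φ t p D g f) (vL κ Φ t p D g f) (kgR κ Φ t p D mk) 0 (kgqY κ Φ t p D g f qxY) (kgWY κ Φ t p D g f (KS.WxYR κ Φ t p D mk g f WxY)) (kgNYv0 κ Φ t p D g f mk qxY WxY)), -kgZY₁ (nL κ Φ t p D g f) (ℓL κ Φ t p D g f) (hL κ Φ t p D g f) (kgR κ Φ t p D mk) 0 (kgqY κ Φ t p D g f qxY) (kgNYv0 κ Φ t p D g f mk qxY WxY) (kgM₁Y (nL κ Φ t p D g f) (vL κ Φ t p D g f) (kgR κ Φ t p D mk) 0 (kgWY κ Φ t p D g f (KS.WxYR κ Φ t p D mk g f WxY)) (kgNYv0 κ Φ t p D g f mk qxY WxY)) (kgM₂Y (nL κ Φ t p D g f) (ℓL κ Φ t p D g f) (hL κ Φ t p D g f) (vL κ Φ t p D g f) (kgR κ Φ t p D mk) 0 (kgqY κ Φ t p D g f qxY) (kgWY κ Φ t p D g f (KS.WxYR κ Φ t p D mk g f WxY)) (kgNYv0 κ Φ t p D g f mk qxY WxY))])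
    (![(((KS.X2R κ Φ t p D mk g f WxY) : ℕ) : ℤ) + kgZY₀ (nL κ Φ t p D g f) (vL κ Φ t p D g f) (kgR κ Φ t p D mk) 0 (kgWY κ Φ t p D g f (KS.WxYR κ Φ t p D mk g f WxY)) (kgNYv0 κ Φ t p D g f mk qxY WxY) (kgM₁Y (nL κ Φ t p D g f) (vL κ Φ t p D g f) (kgR κ Φ t p D mk) 0 (kgWY κ Φ t p D g f (KS.WxYR κ Φ t p D mk g f WxY)) (kgNYv0 κ Φ t p D g f mk qxY WxY)) (kgWm₂Y (nL κ Φ t p D g f) (vL κ Φ t p D g f) (kgR κ Φ t p D mk) 0 (kgWY κ Φ t p D g f (KS.WxYR κ Φ t p D mk g f WxY)) (kgNYv0 κ Φ t p D g f mk qxY WxY)) (kgWp₂Y (nL κ Φ t p D g f) (vL κ Φ t p D g f) (kgR κ Φ t p D mk) 0 (kgWY κ Φ t p D g f (KS.WxYR κ Φ t p D mk g f WxY)) (kgNYv0 κ Φ t p D g f mk qxY WxY)) (kgM₂Y (nL κ Φ t p D g f) (ℓL κ Φ t p D g f) (hL κ Φ t p D g f) (vL κ Φ t p D g f) (kgR κ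 Φ t p D mk) 0 (kgqY κ Φ t p D g f qxY) (kgWY κ Φ t p D g f (KS.WxYR κ Φ t p D mk g f WxY)) (kgNYv0 κ Φ t p D g f mk qxY WxY)), ((((kgNYv0 κ Φ t p D g f mk qxY WxY) : ℕ) : ℤ) + 1) * ((nL κ Φ t p D g f * ℓL κ Φ t p D g f / Skelφ.shearUnit (nL κ Φ t p D g f) (hL κ Φ t p D g f) + 1 : ℕ) : ℤ) + kgZY₁ (nL κ Φ t p D g f) (ℓL κ Φ t p D g f) (hL κ Φ t p D g f) (kgR κ Φ t p D mk) 0 (kgqY κ Φ t p D g f qxY) (kgNYv0 κ Φ t p D g f mk qxY WxY) (kgM₁Y (nL κ Φ t p D g f) (vL κ Φ t p D g f) (kgR κ Φ t p D mk) 0 (kgWY κ Φ t p D g f (KS.WxYR κ Φ t p D mk g f WxY)) (kgNYv0 κ Φ t p D g f mk qxY WxY)) (kgM₂Y (nL κ Φ t p D g f) (ℓL κ Φ t p D g f) (hL κ Φ t p D g f) (vL κ Φ t p D g f) (kgR κ Φ t p D mk) 0 (kgqY κ Φ t p D g f qxY) (kgWY κ Φ t p D g f (KS.WxYR κ Φ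 t p D mk g f WxY)) (kgNYv0 κ Φ t p D g f mk qxY WxY)) + 1])
    (-(3 * (((fcellsA κ Φ t p D g f).r 0 : ℕ) : ℤ)) + 1) (3 * (((fcellsA κ Φ t p D g f).r 0 : ℕ) : ℤ) - 1)
    (-(5 * (((fcellsA κ Φ t p D g f).r 1 : ℕ) : ℤ)) + 1) (25 * (((fcellsA κ Φ t p D g f).r 1 : ℕ) : ℤ) - 1)

/-- **(R-YA) THE ROOT's y′-ARRIVAL READING ROW**: the (C) y′-arrival box `[kgLastLoY (kgNYv0), kgLastHiY (kgNYv0)]` of the rows of record `kgYRows0_of … mk qxY WxY` widened by `(2n_L, sL | n_L, 1)` (`KS.rootBoxY_across/top/bottom_R`) reads within the target cube: `|rd₀ − c1| ≤ b 0 − 1`, `|rd₁ − 20r₁| ≤ b 1 − 1` (`c1 := (fcellsT … c).c 1`, target foot `TargetFootT … b (1, true)`). [this work] -/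
def RowYA (mk g f qxY WxY : ℕ) (c b : Fin 2 → ℕ) (hN : EqNumL κ Φ t p D g f) (hg : gFloorKG κ Φ t p D mk ≤ g) : Prop :=
  ReadRow κ Φ t p D g f
    (![((kgYRows0_of κ Φ t p D g f mk qxY WxY hN hg).kgLastLoY (kgNYv0 κ Φ t p D g f mk qxY WxY)) 0 - 2 * (nL κ Φ t p D g f : ℤ), ((kgYRows0_of κ Φ t p D g f mk qxY WxY hN hg).kgLastLoY (kgNYv0 κ Φ t p D g f mk qxY WxY)) 1 - (kgSL (nL κ Φ t p D g f) (ℓL κ Φ t p D g f) (hL κ Φ t p D g f))])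
    (![((kgYRows0_of κ Φ t p D g f mk qxY WxY hN hg).kgLastHiY (kgNYv0 κ Φ t p D g f mk qxY WxY)) 0 + (nL κ Φ t p D g f : ℤ), ((kgYRows0_of κ Φ t p D g f mk qxY WxY hN hg).kgLastHiY (kgNYv0 κ Φ t p D g f mk qxY WxY)) 1 + 1])
    (((fcellsT κ Φ t p D g f c).c 1 : ℤ) - (b 0 : ℤ) + 1) (((fcellsT κ Φ t p D g f c).c 1 : ℤ) + (b 0 : ℤ) - 1)
    (20 * (((fcellsA κ Φ t p D g f).r 1 : ℕ) : ℤ) - (b 1 : ℤ) + 1) (20 * (((fcellsA κ Φ t p D g f).r 1 : ℕ) : ℤ) + (b 1 : ℤ) - 1)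

end Rows

end KS

end NegB

end PlanarSkeletonFrm

end Summit.CriticalPhenomena.PercolationContinuityZ3.Theorems.Transplant

end
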